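import Summits.MatrixMultiplication.OmegaCensus.SmallFormats.MatMul22nRankGF7XCapCore
import Summits.MatrixMultiplication.OmegaCensus.SmallFormats.MatMul22nRankGF7ThreeNPlusThreeFrom33
import HarnessLib

/-!
# ω-census family (a): reduction of `R_𝔽₇(⟨2,2,n⟩) ≥ 3n + 4` (`n ≥ 51`) to the slack-3 X-cap statement `NoTightPoint7 3 156`

Cell `pub-omega` (unit `pub-omega-tensor-g13`), topic `Summits/MatrixMultiplication/OmegaCensus` (sub-folder `SmallFormats`).
Framing (verbatim): lottery ticket; floor = certified bounds/negative ranges. HONEST FRAMING: a CONDITIONAL reduction, not a bound: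
`NoTightPoint7 3 156` ("the 1274 cap / row-plane rows of `xcapSys7s 3` have no integer point in `[0,3]^401` of total `≥ 156`",
i.e. the census datum `M₇(3) ≤ 155` — decided by the local-identity argument of `pub-omega-tensor-g13/METHOD-MOMENT-g13.md`,
kernel files to follow) implies `3n + 4 ≤ R_𝔽₇(⟨2,2,n⟩)` for every `n ≥ 51`. This is the `𝔽₇` twin of
`MatMul22nRankGF5ThreeNPlusFiveReduction`: the abstraction `rows1274_of_comp` keeps only the 1274 symmetric rows of `xcapSys7s s`
(no WLOG rows, no sandwich normalisation), read off the column lists `capCol7`. Nothing here is progress on `ω`.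
-/

namespace Summit.MatrixMultiplication.OmegaCensus.SmallFormats

open Module Matrix Finset Literature.Computability.AlgebraicComplexity
open Summit.MatrixMultiplication.OmegaCensus.RankOnePlaneCapGeneral

/-- Value of cap row `r < 1274` of the `𝔽₇` X-cap system at an integer point `x` (slack-free: the row is the plain sum of the
variables it lists, `z = x 400` included): `∑_j [r ∈ capCol7 j] · x j`. -/
def capRowVal7 (x : ℕ → ℕ) (r : ℕ) : ℤ := ∑ j ∈ range 401, (if r ∈ capCol7 j then (1 : ℤ) else 0) * (x j : ℤ)

/-- The slack-`s` X-cap statement at target `T` ("`M₇(s) < T`"): no nonnegative integer point of the 1274 cap / row-plane rows of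
`xcapSys7s s` inside the box `[0, s]` has total `≥ T`. The census datum `M₇(3) ≤ 155` is `NoTightPoint7 3 156`. -/
def NoTightPoint7 (s T : ℕ) : Prop :=
  ∀ x : ℕ → ℕ, (∀ j, x j ≤ s) → (∀ r < 1274, capRowVal7 x r ≤ rhs7s s r) → ∑ j ∈ range 401, (x j : ℤ) < T

variable {ι : Type*} [Fintype ι] [DecidableEq ι]

/-- **Abstraction of a computation (slack-generic, symmetric rows only).** The X-form class counts of a computation of `⟨2,2,n⟩`
over `𝔽₇` with `|ι| ≤ 3n + s` products lie in `[0, s]`, satisfy the 1274 cap / row-plane rows of `xcapSys7s s`, and total `|ι|`. -/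
theorem rows1274_of_comp {s n : ℕ} (hι : Fintype.card ι ≤ 3 * n + s)
    (β : BilinComp (mulBilin (ZMod 7) 2 2 n) ι) (u : ι → Fin 2 × Fin 2 → ZMod 7) (hA : ∀ i x, β.f i x = dotX (u i) x) :
    (∀ j, (univ.filter fun t => xvar7 (u t) = j).card ≤ s) ∧
      (∀ r < 1274, capRowVal7 (fun j => (univ.filter fun t => xvar7 (u t) = j).card) r ≤ rhs7s s r) ∧
      ∑ j ∈ range 401, ((univ.filter fun t => xvar7 (u t) = j).card : ℤ) = Fintype.card ι := by
  classical
  set x : ℕ → ℕ := fun j => (univ.filter fun t => xvar7 (u t) = j).card with hx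
  have hcap : ∀ r < 1266, (univ.filter fun t => r ∈ capCol7 (xvar7 (u t))).card ≤ s := by
    intro r hr; have := card_capCol7_cap_le β u hA hr; omega
  have hbox : ∀ j, x j ≤ s := by
    intro j
    by_cases hj : j < 400
    · obtain ⟨r, hr, hr'⟩ := capCol7_capped ⟨j, hj⟩
      refine le_trans ?_ (hcap r hr')
      refine Finset.card_le_card fun t ht => ?_
      simp only [mem_filter, mem_univ, true_and] at ht ⊢
      rw [ht]; exact hr
    · by_cases hj' : j = 400
      · subst hj'
        refine le_trans ?_ (hcap 0 (by norm_num))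
        refine Finset.card_le_card fun t ht => ?_
        simp only [mem_filter, mem_univ, true_and] at ht ⊢
        rw [ht]; simp [capCol7]
      · have : x j = 0 := by
          simp only [hx, Finset.card_eq_zero, Finset.filter_eq_empty_iff]
          intro t _ ht
          have := xvar7_lt (u t); omega
        omega
  refine ⟨hbox, ?_, ?_⟩
  · intro r hr
    unfold capRowVal7
    rw [sum_capA7_xcount7]
    by_cases h1266 : r < 1266
    · have : rhs7s s r = s := by simp [rhs7s, h1266]
      rw [this]; exact_mod_cast hcap r h1266
    · have : rhs7s s r = 2 * (s : ℤ) := by simp [rhs7s, h1266, hr]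
      rw [this]
      have h := card_capCol7_row_le β u hA (not_lt.1 h1266) hr
      have h2 : (univ.filter fun t => r ∈ capCol7 (xvar7 (u t))).card ≤ 2 * s := by omega
      exact_mod_cast h2
  · exact_mod_cast sum_xcount7 u

/-- **Slack-generic reduction.** If the slack-`s` system has no point of total `≥ T`, then every `n` with `T ≤ 3n + s` whose floor
`3n + s ≤ R_𝔽₇(⟨2,2,n⟩)` is already known gets the next floor `3n + s + 1`. -/
theorem floor_succ_of_noTightPoint7 {s T : ℕ} (H : NoTightPoint7 s T) (n : ℕ) (hn : T ≤ 3 * n + s)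
    (hprev : 3 * n + s ≤ tensorRank (matMulTensor (ZMod 7) 2 2 n)) :
    3 * n + s + 1 ≤ tensorRank (matMulTensor (ZMod 7) 2 2 n) := by
  classical
  by_contra hlt
  obtain ⟨w, u, v, hdec⟩ := exists_triad_decomposition_tensorRank (matMulTensor (ZMod 7) 2 2 n)
  have hA : ∀ i x, (bilinCompOfTriads (ZMod 7) w u v hdec).f i x = dotX (u i) x := fun i x => rfl
  have hr : Fintype.card (Fin (tensorRank (matMulTensor (ZMod 7) 2 2 n))) ≤ 3 * n + s := by
    simp only [Fintype.card_fin]; omega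
  obtain ⟨hbox, hrows, htot⟩ := rows1274_of_comp hr (bilinCompOfTriads (ZMod 7) w u v hdec) u hA
  have h := H _ hbox hrows
  rw [htot] at h
  simp only [Fintype.card_fin] at h
  omega

/-- **Reduction for the census cell.** `NoTightPoint7 3 156` (`M₇(3) ≤ 155`) implies `3n + 4 ≤ R_𝔽₇(⟨2,2,n⟩)` for every `n ≥ 51`
(one more than the tree's `3n + 3`, `MatMul22nRankGF7ThreeNPlusThreeFrom33`; the cell `n = 51`, `R ≥ 157`). -/
theorem three_mul_add_four_le_of_noTightPoint7 (H : NoTightPoint7 3 156) (n : ℕ) (hn : 51 ≤ n) :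
    3 * n + 4 ≤ tensorRank (matMulTensor (ZMod 7) 2 2 n) :=
  floor_succ_of_noTightPoint7 H n (by omega) (three_mul_add_three_le_tensorRank_matMulTensor_22n_gf7_from33 n (by omega))

/-- The same reduction for all three orientations `⟨2,2,n⟩`, `⟨2,n,2⟩`, `⟨n,2,2⟩`. -/
theorem three_mul_add_four_le_orientations_of_noTightPoint7 (H : NoTightPoint7 3 156) (n : ℕ) (hn : 51 ≤ n) :
    3 * n + 4 ≤ tensorRank (matMulTensor (ZMod 7) 2 2 n) ∧ 3 * n + 4 ≤ tensorRank (matMulTensor (ZMod 7) 2 n 2) ∧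
      3 * n + 4 ≤ tensorRank (matMulTensor (ZMod 7) n 2 2) := by
  refine ⟨three_mul_add_four_le_of_noTightPoint7 H n hn, ?_, ?_⟩
  · rw [(Blaser2013_lemma55 (ZMod 7) 2 n 2).1]; exact three_mul_add_four_le_of_noTightPoint7 H n hn
  · rw [(Blaser2013_lemma55 (ZMod 7) n 2 2).2.1]; exact three_mul_add_four_le_of_noTightPoint7 H n hn

end Summit.MatrixMultiplication.OmegaCensus.SmallFormats
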